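import Summits.CriticalPhenomena.Ising3DConformalLimit.Theorems.EnergyNotSigmaSquaredGapForcesFarMergingSandwichDefsReg
import Summits.CriticalPhenomena.Ising3DConformalLimit.Theorems.EnergyNotSigmaSquaredGapForcesFarMergingSandwichNearPinchFloor
import Summits.CriticalPhenomena.Ising3DConformalLimit.Theorems.EnergyNotSigmaSquaredGapForcesFarMergingSandwichOctaveCountingAux
import Summits.CriticalPhenomena.Ising3DConformalLimit.Theorems.EnergyNotSigmaSquaredGapForcesFarMergingSandwichTailTightnessFarTail
import Summits.CriticalPhenomena.Ising3DConformalLimit.Theses.MirrorHoelderCompactness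
import HarnessLib

/-! # Octave counting at doubling octaves, modulo two-point doubling
(line `one-cluster-depletion-sandwich` of crux `GapForcesFarMerging`, item stmt-CriticalPhenomena-4468;
registered helpers `octaveCountingReg_of_eventualDoubling`, `octaveCountingReg_of_twoPointDoubling` of the stub
`stub_octaveCountingReg : OnePinchDecay → HazardDominationReg → FarHitIO` of the reshaped skeleton v4)

The v4 reshape asks the per-octave hazard domination only at DOUBLING octaves: `HazardDominationReg` carries,
besides `Doubling θ K` at the far octave, the extra hypothesis `Doubling θ k` at the octave `k` itself
(companion Defs module `…SandwichDefsReg`). The landed counting (`stub_octaveCountingFinal`, sibling file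
`…SandwichOctaveCountingFinal`) telescopes the hazard bound over EVERY octave `k₀ < k ≤ 5K+3`, so with the bound
available only at doubling octaves it needs doubling at all large octaves. This file makes that dependence formal:

* `octaveCountingReg_of_eventualDoubling : (∃ θ > 0, EventualDoubling θ) → OnePinchDecay → HazardDominationReg → FarHitIO`
  — the counting of `…SandwichOctaveCountingFinal` re-run with the near scale `k₀` taken beyond the eventual-doubling
  threshold `kₑ` and the hazard hypothesis fed at the eventual-doubling parameter (then `Doubling θ K` and
  `Doubling θ k` hold at the far octave `K > k₀` and at every octave `k > k₀` of the telescoping; the doubling of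
  `K` supplied by `OnePinchDecay` is not even used). Floor = the landed near-pinch floor `nearPinchFloor`
  (`…SandwichNearPinchFloor`), tail = the landed far tail `TailTightnessProof.farTail_dyadic`
  (`…SandwichTailTightnessFarTail`), elementary lemmas `OctaveCountingProof.*` (`…SandwichOctaveCountingAux`).
* `octaveCountingReg_of_twoPointDoubling : TwoPointDoubling → OnePinchDecay → HazardDominationReg → FarHitIO`, where
  `TwoPointDoubling` (`∃ κ > 0, ∀ n ≥ 1, κ G(n e₁) ≤ G(2n e₁)`) is the EXISTING crux item stmt-CriticalPhenomena-6150 of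
  route `MirrorHoelderCompactness` (open; taken as a HYPOTHESIS, never asserted): with `n = 2^j` it is a doubling
  window at every octave (`forall_doubling_of_twoPointDoubling`), in particular eventual doubling. Also recorded:
  `hazardDominationExt_of_twoPointDoubling : TwoPointDoubling → HazardDominationReg → HazardDominationExt`.

Proof of the counting (by contradiction, as in `…SandwichOctaveCountingFinal`). Assume `¬FarHitIO`. With `κ, C_d`
from `OnePinchDecay` put `ρ = 2^{-κ} < 1`, pick `λ ∈ (0,1)` with `ρ < λ⁵ =: μ` and `1/2 < μ` (Bernoulli), `η = (1-λ)/2`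
and, with `M, k₁, C, ε` from `HazardDominationReg θ` (`θ, kₑ` from eventual doubling), `c = η/(|C|+1)`. By
`¬FarHitIO`, for each of the finitely many injective shapes `y ∈ (Λ_M)⁴` and all dilations `L ≥ J₀`, eventually in
`n`, `meet n (L•y) < c`; choose `k₀ ≥ J₀ + k₁ + kₑ` with `ε_k < η` beyond `k₀`, and `δ₀ > 0` from the near-pinch
floor at radius `2^{k₀}`. Pick (`∃ᶠ K`) an octave `K > k₀` carrying the decay bound with `C_d (ρ/μ)^K < δ₀λ³/2` and
`C_t (2μ)^{-K} < δ₀λ³/2`, then one box size `n` at which decay, far tail, floor, the `5K+3-k₀` hazard bounds (all at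
doubling octaves) and all smallness statements hold. There every hazard is `≤ Cc + ε_k ≤ 1-λ`, so
`avoidIn n (2^{5K+3}) ≥ λ^{5K+3-k₀} δ₀ ≥ δ₀ λ³ μ^K`, while far tail and decay give
`avoidIn n (2^{5K+3}) ≤ C_d ρ^K + C_t 2^{-K} < δ₀ λ³ μ^K`, absurd.
References: Aizenman–Duminil-Copin 2021, §6.2 (6.11)–(6.13), Def. 5.11 and Rem. 5.10; Lawler 1991, ch. 3–5. -/

noncomputable section

namespace Summit.CriticalPhenomena.Ising3DConformalLimit.EnergyNotSigmaSquaredGapForcesFarMergingSandwich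

namespace OctaveCountingRegProof

open scoped symmDiff ENNReal
open MeasureTheory Filter
open Literature.Probability.LatticeModels Literature.Probability.Percolation
open Summit.CriticalPhenomena.Ising3DConformalLimit.GapForcesFarMergingSandwich
open Summit.CriticalPhenomena.Ising3DConformalLimit.Theses.EnergyNotSigmaSquared
open OctaveCountingProof

/-! ### Two-point doubling gives a doubling window at every octave -/

/-- **All-scale two-point doubling gives a doubling window at EVERY octave** (with the same constant). [folklore] -/
theorem forall_doubling_of_twoPointDoubling
    (hTD : Summit.CriticalPhenomena.Ising3DConformalLimit.Theses.MirrorHoelderCompactness.TwoPointDoubling) :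
    ∃ θ : ℝ, 0 < θ ∧ ∀ k : ℕ, Doubling θ k := by
  obtain ⟨κ, hκ, hdoub⟩ := hTD
  refine ⟨κ, hκ, fun k j _ _ => ?_⟩
  -- `2^j • e₁ = (2^j) e₁` and `2^{j+1} • e₁ = (2·2^j) e₁` as `Pi.single`s
  have h₁ : ((2 : ℤ) ^ j) • (e₁ : Site 3) = Pi.single 0 (((2 ^ j : ℕ) : ℤ)) := by
    rw [← Pi.single_smul', smul_eq_mul, mul_one]
    push_cast
    rfl
  have h₂ : ((2 : ℤ) ^ (j + 1)) • (e₁ : Site 3) = Pi.single 0 (2 * ((2 ^ j : ℕ) : ℤ)) := by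
    rw [← Pi.single_smul', smul_eq_mul, mul_one, pow_succ]
    push_cast
    ring_nf
  have h := hdoub (2 ^ j) Nat.one_le_two_pow
  rwa [← h₁, ← h₂] at h

/-- All-scale two-point doubling gives eventual doubling. [folklore] -/
theorem eventualDoubling_of_twoPointDoubling
    (hTD : Summit.CriticalPhenomena.Ising3DConformalLimit.Theses.MirrorHoelderCompactness.TwoPointDoubling) :
    ∃ θ : ℝ, 0 < θ ∧ EventualDoubling θ := by
  obtain ⟨θ, hθ, h⟩ := forall_doubling_of_twoPointDoubling hTD
  exact ⟨θ, hθ, Filter.Eventually.of_forall h⟩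

/-! ### The counting at doubling octaves, given eventual doubling -/

-- adapted from `OctaveCountingFinalProof.farHitIO_of_floor_farTail` (sibling file `…SandwichOctaveCountingFinal`):
-- the hazard hypothesis is `HazardDominationReg` (doubling asked at the octave `k` too), fed at the
-- eventual-doubling parameter; the near scale `k₀` is taken beyond the eventual-doubling threshold.
/-- **Octave counting at doubling octaves, given eventual doubling, the near-pinch floor and the dyadic far tail**:
`OnePinchDecay → HazardDominationReg → FarHitIO` assuming `∃ θ > 0, EventualDoubling θ`, the floor
`∀ R, ∃ δ₀ > 0, ∀ K, R < 2^K → ∀ᶠ n, δ₀ ≤ avoidIn n R (pinch K)` and the far tail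
`∃ C ≥ 0, ∀ K, ∀ᶠ n, ∀ k, avoidIn n (2^{4K+k}) (pinch K) - avoid n (pinch K) ≤ C/2^k` (both proved in sibling files).
[cite: AizenmanDuminilCopinAnnals2021, §6.2 (6.11)–(6.13)] -/
theorem farHitIO_of_floor_farTail_eventualDoubling
    (hfloor : ∀ R : ℕ, ∃ δ₀ : ℝ, 0 < δ₀ ∧ ∀ K : ℕ, R < 2 ^ K → ∀ᶠ n : ℕ in atTop, δ₀ ≤ avoidIn n R (pinch K))
    (htail : ∃ C : ℝ, 0 ≤ C ∧ ∀ K : ℕ, ∀ᶠ n : ℕ in atTop, ∀ k : ℕ,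
      avoidIn n (2 ^ (4 * K + k)) (pinch K) - avoid n (pinch K) ≤ C / 2 ^ k)
    (hev : ∃ θ : ℝ, 0 < θ ∧ EventualDoubling θ)
    (hdecay : OnePinchDecay) (hhaz : HazardDominationReg) : FarHitIO := by
  by_contra hfar
  obtain ⟨κ, Cd, θd, hκ, -, hfreq⟩ := hdecay
  obtain ⟨θ, hθ, hevd⟩ := hev
  have hevd' : ∀ᶠ k : ℕ in atTop, Doubling θ k := hevd
  obtain ⟨kₑ, hkₑ⟩ := Filter.eventually_atTop.1 hevd'
  obtain ⟨M, k₁, Ch, ε, hε, hhazK⟩ := hhaz θ hθ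
  obtain ⟨Ct, hCt, htailK⟩ := htail
  -- the decay rate `ρ = 2^{-κ} < 1`
  set ρ : ℝ := (2 : ℝ) ^ (-κ) with hρ
  have hρpos : 0 < ρ := Real.rpow_pos_of_pos two_pos _
  have hρlt : ρ < 1 := Real.rpow_lt_one_of_one_lt_of_neg one_lt_two (neg_lt_zero.2 hκ)
  -- rates (as in `OctaveCountingFinalProof.exists_rate`): `λ ∈ (0,1)` with `ρ < λ⁵` and `1/2 < λ⁵`, by Bernoulli
  obtain ⟨lam, hlam_pos, hlam_lt, hρμ, hhalfμ⟩ :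
      ∃ lam : ℝ, 0 < lam ∧ lam < 1 ∧ ρ < lam ^ 5 ∧ 1 / 2 < lam ^ 5 := by
    have hσlt : max ρ (1 / 2) < 1 := max_lt hρlt (by norm_num)
    have hρσ : ρ ≤ max ρ (1 / 2) := le_max_left _ _
    have hhalfσ : 1 / 2 ≤ max ρ (1 / 2) := le_max_right _ _
    refine ⟨1 - (1 - max ρ (1 / 2)) / 10, by linarith, by linarith, ?_⟩
    have hB : 1 + ((5 : ℕ) : ℝ) * (-((1 - max ρ (1 / 2)) / 10)) ≤ (1 + -((1 - max ρ (1 / 2)) / 10)) ^ 5 :=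
      one_add_mul_le_pow (by linarith) 5
    have h1 : (1 : ℝ) + -((1 - max ρ (1 / 2)) / 10) = 1 - (1 - max ρ (1 / 2)) / 10 := by ring
    rw [h1] at hB
    push_cast at hB
    constructor <;> linarith
  set μ : ℝ := lam ^ 5 with hμ
  have hμpos : 0 < μ := pow_pos hlam_pos 5
  set η : ℝ := (1 - lam) / 2 with hη
  have hηpos : 0 < η := by rw [hη]; linarith
  set c : ℝ := η / (|Ch| + 1) with hc
  have hcpos : 0 < c := by positivity
  have hCc : Ch * c ≤ η := by
    have h1 : Ch * c ≤ |Ch| * c := mul_le_mul_of_nonneg_right (le_abs_self Ch) hcpos.le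
    have h2 : |Ch| * c ≤ η := by
      rw [hc, mul_div_assoc', div_le_iff₀ (by positivity)]
      nlinarith [abs_nonneg Ch]
    exact h1.trans h2
  -- smallness of the fresh hittings beyond a dilation `J₀`, over the finite family of shapes
  have hfam : ∀ᶠ L : ℕ in atTop, ∀ y ∈ Fintype.piFinset (fun _ : Fin 4 => box 3 M), Function.Injective y →
      ∀ᶠ n : ℕ in atTop, meet n (fun i => (L : ℤ) • y i) < c := by
    refine (Filter.eventually_all_finset _).2 fun y _ => ?_
    by_cases hinj : Function.Injective y
    · exact (eventually_meet_lt_of_not_farHitIO hfar hcpos y hinj).mono fun L hL _ => hL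
    · exact Filter.Eventually.of_forall fun L h => absurd h hinj
  obtain ⟨J₀, hJ₀⟩ := Filter.eventually_atTop.1 hfam
  -- smallness of `ε`
  obtain ⟨k₂, hk₂⟩ := Filter.eventually_atTop.1 (hε.eventually_lt_const hηpos)
  -- the near scale `k₀` (beyond the eventual-doubling threshold `kₑ`) and its floor
  set k₀ : ℕ := J₀ + k₁ + k₂ + kₑ + 1 with hk₀
  obtain ⟨δ₀, hδ₀, hfloorK⟩ := hfloor (2 ^ k₀)
  -- a far octave `K` carrying the decay bound, with `C_d (ρ/μ)^K, C_t (2μ)^{-K} < δ₀ λ³ / 2`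
  have hKev₁ : ∀ᶠ K : ℕ in atTop, Cd * (ρ / μ) ^ K < δ₀ * lam ^ 3 / 2 := by
    have ht : Tendsto (fun K : ℕ => Cd * (ρ / μ) ^ K) atTop (nhds (Cd * 0)) :=
      (tendsto_pow_atTop_nhds_zero_of_lt_one (div_nonneg hρpos.le hμpos.le)
        ((div_lt_one hμpos).2 hρμ)).const_mul Cd
    rw [mul_zero] at ht
    exact ht.eventually_lt_const (by positivity)
  have hKev₂ : ∀ᶠ K : ℕ in atTop, Ct * (2 * μ)⁻¹ ^ K < δ₀ * lam ^ 3 / 2 := by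
    have ht : Tendsto (fun K : ℕ => Ct * (2 * μ)⁻¹ ^ K) atTop (nhds (Ct * 0)) :=
      (tendsto_pow_atTop_nhds_zero_of_lt_one (by positivity)
        (inv_lt_one_of_one_lt₀ (by linarith))).const_mul Ct
    rw [mul_zero] at ht
    exact ht.eventually_lt_const (by positivity)
  obtain ⟨K, ⟨-, hKdec⟩, hKge, hK₁, hK₂⟩ :=
    (hfreq.and_eventually ((eventually_ge_atTop (k₀ + 1)).and (hKev₁.and hKev₂))).exists
  -- everything, eventually in `n`, at this octave (doubling at `K` and at every octave `k > k₀` from `kₑ ≤ k₀`)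
  have htailK' := htailK K
  have hfloorK' := hfloorK K (Nat.pow_lt_pow_right (by norm_num) (by omega))
  have hDK : Doubling θ K := hkₑ K (by omega)
  have hhazev : ∀ᶠ n : ℕ in atTop, ∀ k ∈ Finset.Ioc k₀ (5 * K + 3), ∀ c' : ℝ,
      (∀ y : Fin 4 → Site 3, Function.Injective y → (∀ i, y i ∈ box 3 M) →
          ∀ j : ℕ, k ≤ j + k₁ → j ≤ k + 2 → meet n (fun i => ((2 : ℤ) ^ j) • y i) ≤ c') →
        avoidIn n (2 ^ (k - 1)) (pinch K) - avoidIn n (2 ^ k) (pinch K) ≤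
          (Ch * c' + ε k) * avoidIn n (2 ^ (k - 1)) (pinch K) :=
    (Filter.eventually_all_finset _).2 fun k hk =>
      hhazK k K (by rw [Finset.mem_Ioc] at hk; omega) (Finset.mem_Ioc.1 hk).2 hDK
        (hkₑ k (by rw [Finset.mem_Ioc] at hk; omega))
  have hmeetev : ∀ᶠ n : ℕ in atTop, ∀ j ∈ Finset.Icc J₀ (5 * K + 5),
      ∀ y ∈ Fintype.piFinset (fun _ : Fin 4 => box 3 M), Function.Injective y →
        meet n (fun i => ((2 : ℤ) ^ j) • y i) < c := by
    refine (Filter.eventually_all_finset _).2 fun j hj => (Filter.eventually_all_finset _).2 fun y hy => ?_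
    by_cases hinj : Function.Injective y
    · have hle : J₀ ≤ 2 ^ j := ((Finset.mem_Icc.1 hj).1).trans Nat.lt_two_pow_self.le
      have h := hJ₀ (2 ^ j) hle y hy hinj
      rw [dilate_two_pow] at h
      exact h.mono fun n hn _ => hn
    · exact Filter.Eventually.of_forall fun n h => absurd h hinj
  obtain ⟨n, hn_dec, hn_tail, hn_floor, hn_haz, hn_meet⟩ :=
    (hKdec.and (htailK'.and (hfloorK'.and (hhazev.and hmeetev)))).exists
  -- the per-octave hazard bounds at this `n`
  have hstep : ∀ k : ℕ, k₀ < k → k ≤ 5 * K + 3 →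
      lam * avoidIn n (2 ^ (k - 1)) (pinch K) ≤ avoidIn n (2 ^ k) (pinch K) := by
    intro k hk1 hk2
    have hhyp : ∀ y : Fin 4 → Site 3, Function.Injective y → (∀ i, y i ∈ box 3 M) →
        ∀ j : ℕ, k ≤ j + k₁ → j ≤ k + 2 → meet n (fun i => ((2 : ℤ) ^ j) • y i) ≤ c := by
      intro y hy hbox j hj1 hj2
      exact (hn_meet j (Finset.mem_Icc.2 ⟨by omega, by omega⟩) y (Fintype.mem_piFinset.2 hbox) hy).le
    have hb := hn_haz k (Finset.mem_Ioc.2 ⟨hk1, hk2⟩) c hhyp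
    have hεk : ε k < η := hk₂ k (by omega)
    have ha0 : 0 ≤ avoidIn n (2 ^ (k - 1)) (pinch K) := measureReal_nonneg
    have hrate : (Ch * c + ε k) * avoidIn n (2 ^ (k - 1)) (pinch K) ≤
        (1 - lam) * avoidIn n (2 ^ (k - 1)) (pinch K) :=
      mul_le_mul_of_nonneg_right (by rw [hη] at hCc hεk; linarith) ha0
    linarith
  have hgeo := geometric_lower (a := fun k => avoidIn n (2 ^ k) (pinch K)) hlam_pos.le
    (show k₀ ≤ 5 * K + 3 by omega) hstep
  -- the lower bound from the floor and the telescoping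
  have hlow : δ₀ * lam ^ 3 * μ ^ K ≤ avoidIn n (2 ^ (5 * K + 3)) (pinch K) := by
    have h1 : lam ^ (5 * K + 3) ≤ lam ^ (5 * K + 3 - k₀) :=
      pow_le_pow_of_le_one hlam_pos.le hlam_lt.le (by omega)
    have h2 : lam ^ (5 * K + 3) = lam ^ 3 * μ ^ K := by rw [hμ]; ring
    calc δ₀ * lam ^ 3 * μ ^ K = lam ^ (5 * K + 3) * δ₀ := by rw [h2]; ring
      _ ≤ lam ^ (5 * K + 3 - k₀) * avoidIn n (2 ^ k₀) (pinch K) :=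
          mul_le_mul h1 hn_floor hδ₀.le (pow_nonneg hlam_pos.le _)
      _ ≤ avoidIn n (2 ^ (5 * K + 3)) (pinch K) := hgeo
  -- the upper bound from the far tail and the decay
  have htail₁ : avoidIn n (2 ^ (5 * K + 3)) (pinch K) - avoid n (pinch K) ≤ Ct / 2 ^ (K + 3) := by
    have h := hn_tail (K + 3)
    rwa [show 4 * K + (K + 3) = 5 * K + 3 by omega] at h
  have htail₂ : Ct / 2 ^ (K + 3) ≤ Ct / 2 ^ K :=
    div_le_div_of_nonneg_left hCt (pow_pos two_pos K) (pow_le_pow_right₀ one_le_two (by omega))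
  have hdec : avoid n (pinch K) ≤ Cd * ρ ^ K := by
    have h := hn_dec
    rw [two_pow_rpow_neg, ← hρ] at h
    exact h
  have hup : avoidIn n (2 ^ (5 * K + 3)) (pinch K) < δ₀ * lam ^ 3 * μ ^ K := by
    have h1 : Cd * (ρ / μ) ^ K * μ ^ K = Cd * ρ ^ K := by
      rw [div_pow, mul_assoc, div_mul_cancel₀ _ (pow_ne_zero K hμpos.ne')]
    have h2' : (2 * μ)⁻¹ * μ = (2 : ℝ)⁻¹ := by field_simp
    have h2 : Ct * (2 * μ)⁻¹ ^ K * μ ^ K = Ct / 2 ^ K := by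
      rw [mul_assoc, ← mul_pow, h2', inv_pow, div_eq_mul_inv]
    have h3 : Cd * (ρ / μ) ^ K * μ ^ K < δ₀ * lam ^ 3 / 2 * μ ^ K :=
      mul_lt_mul_of_pos_right hK₁ (pow_pos hμpos K)
    have h4 : Ct * (2 * μ)⁻¹ ^ K * μ ^ K < δ₀ * lam ^ 3 / 2 * μ ^ K :=
      mul_lt_mul_of_pos_right hK₂ (pow_pos hμpos K)
    rw [h1] at h3
    rw [h2] at h4
    linarith
  linarith

/-- **All-scale doubling makes `HazardDominationReg` doubling-free**: fed at the doubling constant, the regular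
hazard domination holds at every octave, hence gives `HazardDominationExt` (for every `θ`). [folklore] -/
theorem hazardDominationExt_of_twoPointDoubling
    (hTD : Summit.CriticalPhenomena.Ising3DConformalLimit.Theses.MirrorHoelderCompactness.TwoPointDoubling)
    (hhaz : HazardDominationReg) : HazardDominationExt := by
  obtain ⟨θ₀, hθ₀, hall⟩ := forall_doubling_of_twoPointDoubling hTD
  obtain ⟨M, k₁, C, ε, hε, hdom⟩ := hhaz θ₀ hθ₀
  intro θ _
  exact ⟨M, k₁, C, ε, hε, fun k K hk hkK _ => hdom k K hk hkK (hall K) (hall k)⟩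

end OctaveCountingRegProof

open Summit.CriticalPhenomena.Ising3DConformalLimit.GapForcesFarMergingSandwich

/-- **S5⁗ modulo EVENTUAL DOUBLING**: one-pinch decay along doubling octaves and hazard domination at the doubling
octaves force far duplicated hitting of ONE dilated injective lattice shape, infinitely often, as soon as all large
octaves double (the near scale of the counting is taken beyond the eventual-doubling threshold; floor = the landed
near-pinch floor `nearPinchFloor`, tail = the landed far tail `TailTightnessProof.farTail_dyadic`).
[cite: AizenmanDuminilCopinAnnals2021, §6.2 (6.11)–(6.13)] -/
theorem octaveCountingReg_of_eventualDoubling : (∃ θ : ℝ, 0 < θ ∧ EventualDoubling θ) → OnePinchDecay → HazardDominationReg → FarHitIO :=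
  OctaveCountingRegProof.farHitIO_of_floor_farTail_eventualDoubling nearPinchFloor TailTightnessProof.farTail_dyadic

/-- **S5⁗ modulo TWO-POINT DOUBLING** (item stmt-CriticalPhenomena-6150, `MirrorHoelderCompactness.TwoPointDoubling`,
taken as a hypothesis): all-scale doubling of the axial two-point function gives a doubling window at every octave, so
the counting at doubling octaves closes. [cite: AizenmanDuminilCopinAnnals2021, §6.2 (6.11)–(6.13) and Rem. 5.10] -/
theorem octaveCountingReg_of_twoPointDoubling : Summit.CriticalPhenomena.Ising3DConformalLimit.Theses.MirrorHoelderCompactness.TwoPointDoubling → OnePinchDecay → HazardDominationReg → FarHitIO :=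
  fun hTD => octaveCountingReg_of_eventualDoubling (OctaveCountingRegProof.eventualDoubling_of_twoPointDoubling hTD)

end Summit.CriticalPhenomena.Ising3DConformalLimit.EnergyNotSigmaSquaredGapForcesFarMergingSandwich

end
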